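import Mathlib
import Literature.AlgebraicGeometry.Resolution.CobordantChartCoefficients
import Literature.AlgebraicGeometry.Resolution.CobordantChartPlaneSlice
import Literature.AlgebraicGeometry.Resolution.CobordantTupleGame
import Literature.AlgebraicGeometry.Resolution.PlaneGermBlowup
import Literature.AlgebraicGeometry.Resolution.PlaneGermNonNCCountRadical
import Literature.AlgebraicGeometry.Resolution.NodalFamilyRingDomain
import Summits.ResolutionOfSingularities.ResolutionOfSingularities.Theorems.WeightedInvariantLocalWeightedDropUnitRoot
import Summits.ResolutionOfSingularities.ResolutionOfSingularities.Theorems.WeightedInvariantLocalWeightedDropTameSliceKappa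
import Summits.ResolutionOfSingularities.ResolutionOfSingularities.Theorems.WeightedInvariantLocalWeightedDropSliceCyl
import Summits.ResolutionOfSingularities.ResolutionOfSingularities.Theorems.WeightedInvariantLocalWeightedDropPlaneBranchDropOfCount

/-!
# `WeightedInvariant.LocalWeightedDrop`, line `hasse-ridge-face-selection`: the plane tuple game is won
# (assembly from the radical count and the monomial phase)

Crux item stmt-ResolutionOfSingularities-8899 (route `ResolutionOfSingularities/WeightedInvariant`), skeleton v16 of
the line, stub `stub_tupleDropPlane`.  HYPOTHESES: (S3a) the radical non-normal-crossing count
`PlaneGermNonNCCountRad k` — a count `ν : k[[y₀,y₁]] → ℕ` with (i) `ν b = 0 ↔ PlaneGerm.IsNC b`, (ii) radical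
monotonicity `b ∣ d^{N+1} → ν b ≤ ν d`, (iii) at a germ whose support is not a normal crossing every exceptional point
`c ≠ 0` of the point blow-up has a slot `i`, `cᵢ ≠ 0`, with `ν (s · G|_{y_i' = 0}) < ν b`; and (S3b) the monomial
phase — for every `e` a rank `μ < ω²` on coefficient tuples which, from a non-zero bad tuple whose support product
`TupleGame.prodSupport` is a normal crossing, drops after some move at every non-zero bad successor while keeping the
support product a normal crossing.  CONCLUSION: `TupleGame.Drop k 2 e` for every `e`.

Proof.  `κ a := ω² · ν (prodSupport a) + μ a`.  If the support product is a normal crossing, S3b's move works: by (i)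
`ν` is `0` before and after, and `μ` drops.  Otherwise play the point blow-up `(X, (1,1))`: from the factorisation data
`a_j (chart) = s^{D_j} · G_j`, `s ∤ G_j` of the non-zero entries, `prodSupport a (chart) = s^{Σ D_j} · Π G_j` with
`s ∤ Π G_j` (`s` is prime), so (iii) gives a slot `i`, `cᵢ ≠ 0`, with `ν (s · (Π G_j)|_{y_i' = 0}) < ν (prodSupport a)`.
The slice `y_i' ↦ 0` is a ring map fixing `s`, and `(Π G_j)| ≠ 0` by the TAME SLICE (`stub_tameSliceKappa`,
`stub_sliceCyl`: the `s`-saturated transform is a unit times a coordinate change of the cylinder over its slice), so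
the new support product `Π' s^{e_j} · G_j|` divides a power of the non-zero germ `s · (Π G_j)|`, and (ii) bounds its
count; `μ < ω²` is absorbed by the lexicographic comparison.
-/

set_option linter.dupNamespace false -- mandated namespace of this single-conjunct summit

namespace Summit.ResolutionOfSingularities.ResolutionOfSingularities.Theorems

open Literature.AlgebraicGeometry.Resolution

namespace TupleDropPlane

open MvPowerSeries

variable {k : Type} [Field k] {e : ℕ}

/-- Lexicographic comparison of `ω²·n + x` with `x < ω²`, first component. -/
theorem omega_sq_mul_add_lt {n n' : ℕ} {x : Ordinal.{0}} (y : Ordinal.{0}) (hx : x < Ordinal.omega0 ^ 2)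
    (h : n < n') :
    Ordinal.omega0 ^ 2 * (n : Ordinal.{0}) + x < Ordinal.omega0 ^ 2 * (n' : Ordinal.{0}) + y :=
  calc Ordinal.omega0 ^ 2 * (n : Ordinal.{0}) + x
      < Ordinal.omega0 ^ 2 * (n : Ordinal.{0}) + Ordinal.omega0 ^ 2 := (add_lt_add_iff_left _).mpr hx
    _ = Ordinal.omega0 ^ 2 * ((n + 1 : ℕ) : Ordinal.{0}) := by rw [Nat.cast_succ, mul_add_one]
    _ ≤ Ordinal.omega0 ^ 2 * (n' : Ordinal.{0}) := mul_le_mul_right (by exact_mod_cast h) _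
    _ ≤ _ := le_self_add

/-- The all-ones weights (the point blow-up) have no zero entry: the crux's convention is vacuous. -/
theorem one_convention {n : ℕ} (c : Fin n → k) : ∀ i : Fin n, (fun _ : Fin n => (1 : ℕ)) i = 0 → c i = 0 :=
  fun _ h => absurd h one_ne_zero

/-! ### The slice `y_i' ↦ 0` as a ring map fixing `s` -/

/-- The slice commutes with powers of the exceptional variable: `(sᵐ · G)| = sᵐ · G|`. -/
theorem slice_X_pow_mul (i : Fin 2) (m : ℕ) (G : MvPowerSeries (Fin 3) k) :
    TupleGame.slice i (X 0 ^ m * G) = X 0 ^ m * TupleGame.slice i G :=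
  PlaneBranchDropOfCount.subst_slice_X_pow_mul i m G

/-- The slice is multiplicative over finite products. -/
theorem slice_prod (i : Fin 2) (f : Fin (e + 1) → MvPowerSeries (Fin 3) k) :
    TupleGame.slice i (∏ j, f j) = ∏ j, TupleGame.slice i (f j) := by
  unfold TupleGame.slice
  rw [← coe_substAlgHom (CobordantChartPlaneSlice.hasSubst_slice (R := k) i), map_prod]

/-- THE SLICE OF AN `s`-SATURATED TRANSFORM AT A LIVE SLOT IS NON-ZERO (the tame slice): in the factorisation
`F(s(c + y)) = sᴬ · G`, `s ∤ G` of the point blow-up, `G|_{y_i' = 0} ≠ 0` whenever `cᵢ ≠ 0`, because `G` is a unit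
times a coordinate change of the cylinder over that slice. -/
theorem slice_ne_zero {n : ℕ} (F : MvPowerSeries (Fin n) k) (c : Fin n → k) (A : ℕ)
    (G : MvPowerSeries (Fin (n + 1)) k)
    (hfac : subst (CobordantChart.chart (fun _ : Fin n => 1) c) F = X 0 ^ A * G) (hG : ¬ X 0 ∣ G)
    (i : Fin n) (hci : c i ≠ 0) : TupleGame.slice i G ≠ 0 := by
  intro h0
  obtain ⟨r, hr1, hrw, hrsupp⟩ := stub_unitRoot k n i.succ 1 (by rw [Nat.cast_one]; exact one_ne_zero) (c i) hci
  obtain ⟨Φ, u, hΦ0, -, -, hg⟩ := stub_tameSliceKappa k n F (fun _ => 1) c (one_convention c) A G hfac i hci r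
    hr1 hrw hrsupp
  have hcyl := stub_sliceCyl k n i G
  have hsl : subst (fun j : Fin (n + 1) => if j = i.succ then (0 : MvPowerSeries (Fin n) k)
      else X (Fin.predAbove i j)) G = 0 := h0
  have hb : HasSubst (fun m : Fin n => (X ((Fin.succ i).succAbove m) : MvPowerSeries (Fin (n + 1)) k)) :=
    hasSubst_of_constantCoeff_zero fun m => by simp [constantCoeff_X]
  rw [hsl, ← coe_substAlgHom hb, map_zero] at hcyl
  rw [← hcyl, ← coe_substAlgHom (hasSubst_of_constantCoeff_zero hΦ0), map_zero, mul_zero] at hg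
  exact hG (hg ▸ dvd_zero _)

/-! ### The point blow-up of a tuple whose support product is not a normal crossing -/

open scoped Classical in
/-- TRANSFORM OF THE SUPPORT PRODUCT under the point blow-up chart: with the factorisation data
`a_j (chart) = s^{D_j} · G_j` of the non-zero entries, `prodSupport a (chart) = s^{Σ D_j} · Π G_j`, and `s ∤ Π G_j`
when `s ∤ G_j` for all `j` (`s` is prime). -/
theorem subst_chart_prodSupport (a : Fin (e + 1) → MvPowerSeries (Fin 2) k) (c : Fin 2 → k)
    (D : Fin (e + 1) → ℕ) (G : Fin (e + 1) → MvPowerSeries (Fin 3) k)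
    (hfac : ∀ j, a j ≠ 0 →
      subst (CobordantChart.chart (fun _ : Fin 2 => 1) c) (a j) = X 0 ^ D j * G j ∧ ¬ X 0 ∣ G j) :
    subst (CobordantChart.chart (fun _ : Fin 2 => 1) c) (TupleGame.prodSupport a) =
      X 0 ^ (∑ j, if a j = 0 then 0 else D j) * ∏ j, (if a j = 0 then 1 else G j) ∧
    ¬ X (0 : Fin 3) ∣ ∏ j, (if a j = 0 then (1 : MvPowerSeries (Fin 3) k) else G j) := by
  have hs := CobordantChart.hasSubst_chart (fun _ : Fin 2 => 1) c (one_convention c)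
  constructor
  · unfold TupleGame.prodSupport
    rw [← coe_substAlgHom hs, map_prod, ← Finset.prod_pow_eq_pow_sum, ← Finset.prod_mul_distrib]
    refine Finset.prod_congr rfl fun j _ => ?_
    by_cases hj : a j = 0
    · rw [if_pos hj, if_pos hj, if_pos hj, map_one, pow_zero, one_mul]
    · rw [if_neg hj, if_neg hj, if_neg hj, coe_substAlgHom, (hfac j hj).1]
  · intro h
    obtain ⟨j, -, hj⟩ := (MvPowerSeries.prime_X' k (0 : Fin 3)).exists_mem_finset_dvd h
    by_cases hj0 : a j = 0
    · rw [if_pos hj0] at hj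
      exact (MvPowerSeries.prime_X' k (0 : Fin 3)).not_dvd_one hj
    · rw [if_neg hj0] at hj
      exact (hfac j hj0).2 hj

open scoped Classical in
/-- THE NEW SUPPORT PRODUCT DIVIDES A POWER OF THE COUNTED SLICE: the support product of the successor tuple
`(s^{e_j} · G_j)|_{y_i' = 0}` (zero entries dropped) divides `(s · (Π G_j)|_{y_i' = 0})^{Σ e_j + e + 1}`. -/
theorem prodSupport_newTuple_dvd (a : Fin (e + 1) → MvPowerSeries (Fin 2) k) (D : Fin (e + 1) → ℕ)
    (G : Fin (e + 1) → MvPowerSeries (Fin 3) k) (i : Fin 2) :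
    TupleGame.prodSupport (TupleGame.newTuple a D G i) ∣
      (X 0 * TupleGame.slice i (∏ j, if a j = 0 then (1 : MvPowerSeries (Fin 3) k) else G j)) ^
        ((∑ j, (D j - TupleGame.marking e j * TupleGame.floorWeight a D) + e) + 1) := by
  set W := TupleGame.floorWeight a D
  have hT : ∀ j, a j ≠ 0 → X 0 * TupleGame.slice i (G j) ∣
      X 0 * TupleGame.slice i (∏ j, if a j = 0 then (1 : MvPowerSeries (Fin 3) k) else G j) := by
    intro j hj
    refine mul_dvd_mul_left _ ?_
    rw [slice_prod]
    have h := Finset.dvd_prod_of_mem (fun l => TupleGame.slice i (if a l = 0 then (1 : MvPowerSeries (Fin 3) k)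
      else G l)) (Finset.mem_univ j)
    rwa [if_neg hj] at h
  have hsum : (∑ j, (D j - TupleGame.marking e j * W) + e) + 1 = ∑ j : Fin (e + 1), (D j - TupleGame.marking e j * W + 1) := by
    rw [Finset.sum_add_distrib, Finset.sum_const, Finset.card_univ, Fintype.card_fin, smul_eq_mul, mul_one,
      add_assoc]
  rw [hsum, ← Finset.prod_pow_eq_pow_sum]
  unfold TupleGame.prodSupport
  refine Finset.prod_dvd_prod_of_dvd _ _ fun j _ => ?_
  split_ifs with hnew
  · exact one_dvd _
  · have hj : a j ≠ 0 := by
      intro h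
      apply hnew
      unfold TupleGame.newTuple
      rw [if_pos h]
    refine dvd_trans ?_ (pow_dvd_pow_of_dvd (hT j hj) _)
    unfold TupleGame.newTuple
    rw [if_neg hj, slice_X_pow_mul]
    exact ⟨TupleGame.slice i (G j) ^ (D j - TupleGame.marking e j * W) * X 0, by ring⟩

/-- THE POINT BLOW-UP CLAUSE.  If the support product of `a` is not a normal crossing, then at every exceptional
point `c ≠ 0` of the point blow-up, for every factorisation data of the non-zero entries, the slot `i` provided by
(iii) for `prodSupport a` has `ν (prodSupport (newTuple a D G i)) < ν (prodSupport a)`. -/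
theorem blowup_clause (ν : MvPowerSeries (Fin 2) k → ℕ)
    (hν2 : ∀ b d : MvPowerSeries (Fin 2) k, d ≠ 0 → ∀ N : ℕ, b ∣ d ^ (N + 1) → ν b ≤ ν d)
    (hν3 : ∀ b : MvPowerSeries (Fin 2) k, b ≠ 0 → ¬ PlaneGerm.IsNC b →
        ∀ c : Fin 2 → k, c ≠ 0 → ∀ (A : ℕ) (G : MvPowerSeries (Fin 3) k),
          subst (CobordantChart.chart (fun _ : Fin 2 => 1) c) b = X 0 ^ A * G →
          ¬ (X (0 : Fin 3) ∣ G) →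
          ∃ i : Fin 2, c i ≠ 0 ∧ ν (X 0 * TupleGame.slice i G) < ν b)
    (a : Fin (e + 1) → MvPowerSeries (Fin 2) k) (hnc : ¬ PlaneGerm.IsNC (TupleGame.prodSupport a))
    (c : Fin 2 → k) (hc0 : c ≠ 0) (D : Fin (e + 1) → ℕ) (G : Fin (e + 1) → MvPowerSeries (Fin 3) k)
    (hfac : ∀ j, a j ≠ 0 →
      subst (CobordantChart.chart (fun _ : Fin 2 => 1) c) (a j) = X 0 ^ D j * G j ∧ ¬ X 0 ∣ G j) :
    ∃ i : Fin 2, c i ≠ 0 ∧ ν (TupleGame.prodSupport (TupleGame.newTuple a D G i)) < ν (TupleGame.prodSupport a) := by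
  classical
  obtain ⟨hprod, hndvd⟩ := subst_chart_prodSupport a c D G hfac
  obtain ⟨i, hci, hlt⟩ := hν3 _ (TupleGame.prodSupport_ne_zero a) hnc c hc0 _ _ hprod hndvd
  refine ⟨i, hci, lt_of_le_of_lt (hν2 _ _ ?_ _ (prodSupport_newTuple_dvd a D G i)) hlt⟩
  exact mul_ne_zero (MvPowerSeries.prime_X' k (0 : Fin 2)).ne_zero
    (slice_ne_zero _ c _ _ hprod hndvd i hci)

end TupleDropPlane

open TupleDropPlane in
/-- S3c — THE PLANE TUPLE GAME IS WON (assembly, every field): from the radical count (S3a) and the monomial phase (S3b),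
`TupleGame.Drop k 2 e` for every `e`.  Proof sketch: `κ a := ω²·ν(prodSupport a) + μ a`.  If the support product is a normal
crossing use S3b's move (`ν` stays `0` by (i), `μ` drops).  Otherwise play the point blow-up `(X, (1,1))`: with the factorisation
data `a_j(chart) = s^{D_j} G_j` one has `prodSupport a (chart) = s^{Σ D_j}·Π G_j`, `s ∤ Π G_j` (`s` prime), so (iii) gives a slot
`i`, `c_i ≠ 0`, with `ν(s·(Π G_j)|_{y_i'=0}) < ν(prodSupport a)`; the new support product is `s^E·Π (G_j|_{y_i'=0})`
(`slice` is a ring map fixing `s`; entries stay non-zero since the sliced chart substitution is injective), which divides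
`(s·Π G_j|)^{E+1}`, so (ii) bounds its `ν`; `μ < ω²` is absorbed. -/
theorem stub_tupleDropPlane : ∀ (k : Type) [Field k], PlaneGermNonNCCountRad k →
    (∀ e : ℕ, ∃ μ : (Fin (e + 1) → MvPowerSeries (Fin 2) k) → Ordinal.{0},
      (∀ a, μ a < Ordinal.omega0 ^ 2) ∧
      ∀ a : Fin (e + 1) → MvPowerSeries (Fin 2) k, a ≠ 0 → TupleGame.Bad a →
        PlaneGerm.IsNC (TupleGame.prodSupport a) →
        TupleGame.StepDrop μ (fun b => PlaneGerm.IsNC (TupleGame.prodSupport b)) a) →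
    ∀ e : ℕ, TupleGame.Drop k 2 e := by
  intro k _ hrad hmono e
  obtain ⟨ν, hν1, hν2, hν3⟩ := hrad
  obtain ⟨μ, hμlt, hμstep⟩ := hmono e
  refine ⟨fun a => Ordinal.omega0 ^ 2 * (ν (TupleGame.prodSupport a) : Ordinal.{0}) + μ a, ?_⟩
  intro a ha hbad
  by_cases hnc : PlaneGerm.IsNC (TupleGame.prodSupport a)
  · -- normal-crossing support product: the monomial phase's move; `ν` stays `0`, `μ` drops
    obtain ⟨Φ, w, hΦ0, hdet, hw1, hwpos, hstep⟩ := hμstep a ha hbad hnc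
    refine ⟨Φ, w, hΦ0, hdet, hw1, hwpos, ?_⟩
    intro c hc hc0 D G hfac
    obtain ⟨i, hci, hi⟩ := hstep c hc hc0 D G hfac
    refine ⟨i, hci, fun hne hbad' => ⟨trivial, ?_⟩⟩
    obtain ⟨hncnew, hμlt'⟩ := hi hne hbad'
    have h1 : ν (TupleGame.prodSupport (TupleGame.newTuple a D G i)) = 0 :=
      (hν1 _ (TupleGame.prodSupport_ne_zero _)).mpr hncnew
    have h2 : ν (TupleGame.prodSupport a) = 0 := (hν1 _ (TupleGame.prodSupport_ne_zero _)).mpr hnc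
    dsimp only
    rw [h1, h2]
    exact (add_lt_add_iff_left _).mpr hμlt'
  · -- not a normal crossing: the point blow-up `(X, (1,1))`; `ν` drops at every successor
    refine ⟨MvPowerSeries.X, fun _ => 1, fun i => MvPowerSeries.constantCoeff_X i,
      PlaneBranchDropOfCount.isUnit_det_X, fun _ => le_rfl, ⟨0, Nat.one_pos⟩, ?_⟩
    intro c _ hc0 D G hfac
    have hfac' : ∀ j, a j ≠ 0 → MvPowerSeries.subst (CobordantChart.chart (fun _ : Fin 2 => 1) c) (a j) =
        MvPowerSeries.X 0 ^ D j * G j ∧ ¬ MvPowerSeries.X 0 ∣ G j := by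
      intro j hj
      have h := hfac j hj
      rwa [MvPowerSeries.subst_self] at h
    obtain ⟨i, hci, hlt⟩ := blowup_clause ν hν2 hν3 a hnc c hc0 D G hfac'
    exact ⟨i, hci, fun _ _ => ⟨trivial, omega_sq_mul_add_lt _ (hμlt _) hlt⟩⟩

end Summit.ResolutionOfSingularities.ResolutionOfSingularities.Theorems
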